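import Summits.HodgeConjecture.HodgeConjecture.Theorems.F0P3cStCharTSTypeThreeTorus        -- ★ «T3-ALG★» (A)+(B): test matrix, `exists_imaginary_valuation_log_not_dvd_three`, `pow_three_add_algebraMap_ne_zero`, `cmLocalForm_three_eq`
import Summits.HodgeConjecture.HodgeConjecture.Theorems.F0P3cStCharTSTypeThreeCentralizer  -- ★ «T3-CENT★» (LH1-p01): (Z3) `not_isRoot_charpoly_of_commute_of_isRegularElt`
import Mathlib.NumberTheory.NumberField.Completion.FinitePlace                            -- Mathlib: `instNormedFieldValuedAdicCompletion`
import HarnessLib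

/-!
# Crux `H413`, line LH6 (StCharTS) — brick «T3-NEBOT★»: the REGULAR elements of the type-(3) torus accumulate at `1`
# (`𝓝[T ∩ regular] 1 ≠ ⊥` in `U(Φ₃)(L⁺_v)` at a non-split place — the vacuity shield of the package's (GERM-3) clause)

Cell `hodgecm-mathlib` (D-0151), FLOOR 0, crux item H413 = `stmt-HodgeConjecture-24833`; line LH6 = closer stub `stub_StCharTS`, leaf
`Cruxes/H413/Lines/F0_P3c_StCharTSPaydown.lean` ED. 5, organ (S-𝔇) `stub_EllipticPackage`, conjuncts (T3) and (GERM-3) «the constant term of the germ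
expansion of `Φ(γ, f)`, `γ ∈ Tʳ` near `1`» [Rogawski1990 L. 12.7.2 (proof) p. 194; §8.1].  DEAL «T3-NEBOT★» of F0P3b-plan (g23) 2026-09-02T05:45Z to
LH1-p03 (g2); `--supports stmt-HodgeConjecture-24833 --as helper`.  THEOREMS ONLY (no `def`, no instance, no notation, no named fact, no `sorry`); ★-only
imports + Mathlib.

THE POINT.  (GERM-3) is a statement about the filter `𝓝[(T ∩ 𝔇.regG)] (1 : U(Φ₃)(L⁺_v))`; were that filter `⊥` (no regular element of `T` near `1`), its
second clause «`∀ κ, (∀ᶠ γ, α γ = κ) → κ = 0`» would hold for EVERY `κ` and REFUTE the package.  This file shows the filter is NON-TRIVIAL for the type-(3)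
torus of ★ «T3-ALG★»∕«T3-LINK★»: `T := centraliser {γ₀}` of a regular elliptic `γ₀ = Cayley(X)`, `X = !![0,0,c₀; 1,0,0; 0,−1,0]`, `c̄₀ = −c₀`,
`3 ∤ v_w(c₀)`.

THE ROAD (no matrix-inverse continuity, no minimal polynomials).  Scale the Lie element: `X_k := s^k • X` with `s = b b̄ ∈ L⁺` (`b` a uniformiser at the
place `w ∣ v`, so `s̄ = s`, `v_w(s) = −2`): `X_k` stays in `𝔲(Φ₃)`, `χ_{X_k} = t³ + s^{3k} c₀` still has `3 ∤ v_w`, so EVERY Cayley transform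
`γ_k = (1 + X_k)(1 − X_k)⁻¹` is a unitary (★ «CAYLEY★», LH1-p01) REGULAR element (irreducible `χ`, ★ (A)), all in `R[X]` hence commuting, hence in
`T = centraliser {γ_0}`; and since `X_k³ = −ε_k · 1` (`ε_k = s^{3k} c₀ → 0`) the inverses are EXPLICIT — `(1 − X_k)⁻¹ = u_k (1 + X_k + X_k²)`,
`(1 + ε_k) u_k = 1` — so `γ_k = u_k ((1 − ε_k)·1 + 2X_k + 2X_k²) → 1` and `γ_k⁻¹ = u'_k ((1 + ε_k)·1 − 2X_k + 2X_k²) → 1` by continuity of the ring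
operations alone (the scalar limits `u_k → 1` are read in the normed field `L_w`, Mathlib `instNormedFieldValuedAdicCompletion`), i.e. `γ_k → 1` in the
`GL`-topology of `Gqs L v`, whence `1 ∈ closure (T ∩ regular)`.

* §1 closed forms over any commutative ring (`X³ = −ε·1`): `testMatrix_pow_three`, `one_sub_mul_eq_one_of_pow_three` ∕ `one_add_mul_eq_one_of_pow_three`,
  `one_sub_inv_eq_of_pow_three` ∕ `one_add_inv_eq_of_pow_three`, `cayley_eq_smul_of_pow_three` ∕ `cayleyInv_eq_smul_of_pow_three`, `cayley_mul_cayleyInv`,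
  `transpose_map_smul_mul_eq` (scaling a Lie element by a `σ`-fixed scalar), `charpoly_smul_testMatrix` (`χ_{s • X_c} = t³ + s³c`),
  `mem_adjoin_cayleyClosedForm` (the closed form lies in `R[X]`);
* §2 limits: `tendsto_cayley_closedForm` ∕ `tendsto_cayleyInv_closedForm` (topological ring), and at a non-split place of the CM field:
  `exists_real_valuation_eq_exp_neg_two` (`s = b b̄`), `tendsto_pow_algebraMap_localRing` (`s^k → 0` in `Π_{w ∣ v} L_w`), `tendsto_of_one_add_mul_eq_one`
  (`(1 + e_k) u_k = 1`, `e_k → 0` ⟹ `u_k → 1`);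
* §3 **`nhdsWithin_typeThree_regular_neBot`** — the statement dealt: `∃ T ≤ Gqs L v, (∃ γ ∈ T, regular) ∧ (∀ γ ∈ T, regular → ∀ c, ¬ χ_γ.IsRoot c) ∧
  (𝓝[T ∩ {regular}] 1).NeBot`.

HONEST LABEL: count-neutral (T3)∕(GERM-3) package brick; HC_CM is proved only modulo the 7 printed citations (2 remaining: hLiu418 = stmt-HodgeConjecture-24832,
h413 = stmt-HodgeConjecture-24833) until rung 0 closes.

## References
* [Rogawski1990] J. D. Rogawski, *Automorphic Representations of Unitary Groups in Three Variables*, Ann. of Math. Stud. 123 (1990): §3.6 (Cartan subgroups of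
  type (3)), §8.1 (germ expansions), Lemma 12.7.2 (proof) p. 194.
-/

set_option autoImplicit false
-- the mandated namespace has the single-problem summit's repeated segment (`HodgeConjecture.HodgeConjecture`)
set_option linter.dupNamespace false

namespace Summit.HodgeConjecture.HodgeConjecture.Cruxes.H413.F0P3cStCharTSTypeThreeNhds

open NumberField IsDedekindDomain Filter Topology Polynomial
open scoped Matrix
open Literature.NumberTheory.Automorphic Literature.NumberTheory.Automorphic.UnitaryGroup
open Literature.NumberTheory.Rogawski1990
open Summit.HodgeConjecture.HodgeConjecture.Cruxes.H413.F0P3cStCharTSCayleyUnitary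
open Summit.HodgeConjecture.HodgeConjecture.Cruxes.H413.F0P3cStCharTSTypeThreeTorus
open Summit.HodgeConjecture.HodgeConjecture.Cruxes.H413.F0P3cStCharTSTypeThreeCentralizer

/-! ## §1 Closed forms of the Cayley transform of `X` with `X³ = −ε·1` (any commutative ring) -/

section ClosedForms

variable {R : Type*} [CommRing R]

/-- `X_c³ = −c·1` for the test matrix of ★ «T3-ALG★». [cite: Rogawski1990, §3.6] -/
theorem testMatrix_pow_three (c : R) :
    ((!![0, 0, c; 1, 0, 0; 0, -1, 0] : Matrix (Fin 3) (Fin 3) R)) ^ 3 = -(c • (1 : Matrix (Fin 3) (Fin 3) R)) := by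
  ext i j
  fin_cases i <;> fin_cases j <;> simp [pow_succ, Matrix.mul_apply, Fin.sum_univ_three]

/-- `(s • X_c)³ = −(s³c)·1`. [cite: Rogawski1990, §3.6] -/
theorem smul_testMatrix_pow_three (s c : R) :
    (s • (!![0, 0, c; 1, 0, 0; 0, -1, 0] : Matrix (Fin 3) (Fin 3) R)) ^ 3 = -((s ^ 3 * c) • (1 : Matrix (Fin 3) (Fin 3) R)) := by
  rw [_root_.smul_pow, testMatrix_pow_three, smul_neg, smul_smul]

/-- `χ_{s • X_c} = t³ + s³c`. [cite: Rogawski1990, §3.6] -/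
theorem charpoly_smul_testMatrix (s c : R) :
    (s • (!![0, 0, c; 1, 0, 0; 0, -1, 0] : Matrix (Fin 3) (Fin 3) R)).charpoly = X ^ 3 + C (s ^ 3 * c) := by
  rw [Matrix.charpoly, Matrix.det_fin_three]
  simp
  ring

/-- Scaling a Lie-algebra element by a `σ`-fixed scalar keeps it in the Lie algebra: `((s•X).map σ)ᵀ J = −J (s•X)`. [cite: Rogawski1990, §3.6] -/
theorem transpose_map_smul_mul_eq (σ : R →+* R) {J X : Matrix (Fin 3) (Fin 3) R} (hX : (X.map σ)ᵀ * J = -(J * X)) {s : R}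
    (hs : σ s = s) : ((s • X).map σ)ᵀ * J = -(J * (s • X)) := by
  have hmap : (s • X).map σ = s • X.map σ := by
    ext i j
    simp only [Matrix.map_apply, Matrix.smul_apply, smul_eq_mul, map_mul, hs]
  rw [hmap, Matrix.transpose_smul, Matrix.smul_mul, hX, Matrix.mul_smul, smul_neg]

/-- `u · (1 + ε·1) = 1` in `M₃(R)` when `(1 + ε) u = 1`. [folklore] -/
private theorem smul_one_add_smul_one_eq_one {ε u : R} (hu : (1 + ε) * u = 1) :
    u • ((1 : Matrix (Fin 3) (Fin 3) R) + ε • 1) = 1 := by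
  rw [smul_add, smul_smul, ← add_smul, show u + u * ε = (1 + ε) * u by ring, hu, one_smul]

/-- `(1 − X) · (u (1 + X + X²)) = 1` when `X³ = −ε·1`, `(1+ε)u = 1`. [cite: Rogawski1990, §3.6] -/
theorem one_sub_mul_eq_one_of_pow_three (X : Matrix (Fin 3) (Fin 3) R) {ε u : R} (hX : X ^ 3 = -(ε • (1 : Matrix (Fin 3) (Fin 3) R)))
    (hu : (1 + ε) * u = 1) : (1 - X) * (u • (1 + X + X ^ 2)) = 1 := by
  rw [Matrix.mul_smul, show (1 - X) * (1 + X + X ^ 2) = 1 - X ^ 3 by noncomm_ring, hX, sub_neg_eq_add]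
  exact smul_one_add_smul_one_eq_one hu

/-- `(1 + X) · (u' (1 − X + X²)) = 1` when `X³ = −ε·1`, `(1−ε)u' = 1`. [cite: Rogawski1990, §3.6] -/
theorem one_add_mul_eq_one_of_pow_three (X : Matrix (Fin 3) (Fin 3) R) {ε u' : R} (hX : X ^ 3 = -(ε • (1 : Matrix (Fin 3) (Fin 3) R)))
    (hu' : (1 - ε) * u' = 1) : (1 + X) * (u' • (1 - X + X ^ 2)) = 1 := by
  rw [Matrix.mul_smul, show (1 + X) * (1 - X + X ^ 2) = 1 + X ^ 3 by noncomm_ring, hX, ← sub_eq_add_neg]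
  have hu'' : (1 + (-ε)) * u' = 1 := by rw [← sub_eq_add_neg]; exact hu'
  have := smul_one_add_smul_one_eq_one (R := R) hu''
  rwa [neg_smul, ← sub_eq_add_neg] at this

/-- `(1 − X)⁻¹ = u (1 + X + X²)`. [cite: Rogawski1990, §3.6] -/
theorem one_sub_inv_eq_of_pow_three (X : Matrix (Fin 3) (Fin 3) R) {ε u : R} (hX : X ^ 3 = -(ε • (1 : Matrix (Fin 3) (Fin 3) R)))
    (hu : (1 + ε) * u = 1) : (1 - X)⁻¹ = u • (1 + X + X ^ 2) :=
  Matrix.inv_eq_right_inv (one_sub_mul_eq_one_of_pow_three X hX hu)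

/-- `(1 + X)⁻¹ = u' (1 − X + X²)`. [cite: Rogawski1990, §3.6] -/
theorem one_add_inv_eq_of_pow_three (X : Matrix (Fin 3) (Fin 3) R) {ε u' : R} (hX : X ^ 3 = -(ε • (1 : Matrix (Fin 3) (Fin 3) R)))
    (hu' : (1 - ε) * u' = 1) : (1 + X)⁻¹ = u' • (1 - X + X ^ 2) :=
  Matrix.inv_eq_right_inv (one_add_mul_eq_one_of_pow_three X hX hu')

/-- **The Cayley transform in closed form**: `(1+X)(1−X)⁻¹ = u ((1−ε)·1 + 2X + 2X²)`. [cite: Rogawski1990, §3.6] -/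
theorem cayley_eq_smul_of_pow_three (X : Matrix (Fin 3) (Fin 3) R) {ε u : R} (hX : X ^ 3 = -(ε • (1 : Matrix (Fin 3) (Fin 3) R)))
    (hu : (1 + ε) * u = 1) :
    (1 + X) * (1 - X)⁻¹ = u • ((1 - ε) • (1 : Matrix (Fin 3) (Fin 3) R) + 2 • X + 2 • X ^ 2) := by
  rw [one_sub_inv_eq_of_pow_three X hX hu, Matrix.mul_smul]
  congr 1
  rw [show (1 + X) * (1 + X + X ^ 2) = 1 + 2 • X + 2 • X ^ 2 + X ^ 3 by noncomm_ring, hX, sub_smul, one_smul]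
  abel

/-- **The inverse Cayley transform in closed form**: `(1−X)(1+X)⁻¹ = u' ((1+ε)·1 − 2X + 2X²)`. [cite: Rogawski1990, §3.6] -/
theorem cayleyInv_eq_smul_of_pow_three (X : Matrix (Fin 3) (Fin 3) R) {ε u' : R} (hX : X ^ 3 = -(ε • (1 : Matrix (Fin 3) (Fin 3) R)))
    (hu' : (1 - ε) * u' = 1) :
    (1 - X) * (1 + X)⁻¹ = u' • ((1 + ε) • (1 : Matrix (Fin 3) (Fin 3) R) - 2 • X + 2 • X ^ 2) := by
  rw [one_add_inv_eq_of_pow_three X hX hu', Matrix.mul_smul]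
  congr 1
  rw [show (1 - X) * (1 - X + X ^ 2) = 1 - 2 • X + 2 • X ^ 2 - X ^ 3 by noncomm_ring, hX, add_smul, one_smul]
  abel

/-- `(1+X)(1−X)⁻¹ · (1−X)(1+X)⁻¹ = 1`. [folklore] -/
theorem cayley_mul_cayleyInv (X : Matrix (Fin 3) (Fin 3) R) (h1 : IsUnit (1 - X).det) (h2 : IsUnit (1 + X).det) :
    (1 + X) * (1 - X)⁻¹ * ((1 - X) * (1 + X)⁻¹) = 1 := by
  rw [Matrix.mul_assoc, ← Matrix.mul_assoc (1 - X)⁻¹, Matrix.nonsing_inv_mul _ h1, Matrix.one_mul, Matrix.mul_nonsing_inv _ h2]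

/-- The closed form `u ((a)·1 + 2(t•X) + 2(t•X)²)` lies in the commutative subalgebra `R[X]`. [folklore] -/
theorem mem_adjoin_cayleyClosedForm (X : Matrix (Fin 3) (Fin 3) R) (u a t : R) :
    u • (a • (1 : Matrix (Fin 3) (Fin 3) R) + 2 • (t • X) + 2 • (t • X) ^ 2) ∈ Algebra.adjoin R ({X} : Set (Matrix (Fin 3) (Fin 3) R)) := by
  refine Subalgebra.smul_mem _ (add_mem (add_mem (Subalgebra.smul_mem _ (one_mem _) _) (nsmul_mem ?_ 2)) (nsmul_mem (pow_mem ?_ 2) 2)) _ <;>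
    exact Subalgebra.smul_mem _ (Algebra.self_mem_adjoin_singleton R X) _

end ClosedForms

/-! ## §2 Limits: the closed forms tend to `1`; scalars at a non-split place of the CM field -/

section Limits

variable {R : Type*} [CommRing R] [TopologicalSpace R] [IsTopologicalRing R]

/-- The closed-form Cayley family tends to `1` when `u → 1`, `ε → 0`, `s → 0`. [folklore] -/
theorem tendsto_cayley_closedForm (X : Matrix (Fin 3) (Fin 3) R) {ι : Type*} {l : Filter ι} (u ε s : ι → R)
    (hu : Tendsto u l (𝓝 1)) (hε : Tendsto ε l (𝓝 0)) (hs : Tendsto s l (𝓝 0)) :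
    Tendsto (fun k => u k • ((1 - ε k) • (1 : Matrix (Fin 3) (Fin 3) R) + 2 • (s k • X) + 2 • (s k • X) ^ 2)) l (𝓝 1) := by
  have h1 : Tendsto (fun k => (1 - ε k) • (1 : Matrix (Fin 3) (Fin 3) R)) l (𝓝 (((1 : R) - 0) • (1 : Matrix (Fin 3) (Fin 3) R))) :=
    ((tendsto_const_nhds (x := (1 : R))).sub hε).smul_const (1 : Matrix (Fin 3) (Fin 3) R)
  have h2 : Tendsto (fun k => 2 • (s k • X)) l (𝓝 (2 • ((0 : R) • X))) := (hs.smul_const _).const_smul 2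
  have h3 : Tendsto (fun k => 2 • (s k • X) ^ 2) l (𝓝 (2 • ((0 : R) • X) ^ 2)) := ((hs.smul_const _).pow 2).const_smul 2
  have := hu.smul ((h1.add h2).add h3)
  simpa using this

/-- The closed-form inverse Cayley family tends to `1` when `u' → 1`, `ε → 0`, `s → 0`. [folklore] -/
theorem tendsto_cayleyInv_closedForm (X : Matrix (Fin 3) (Fin 3) R) {ι : Type*} {l : Filter ι} (u' ε s : ι → R)
    (hu' : Tendsto u' l (𝓝 1)) (hε : Tendsto ε l (𝓝 0)) (hs : Tendsto s l (𝓝 0)) :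
    Tendsto (fun k => u' k • ((1 + ε k) • (1 : Matrix (Fin 3) (Fin 3) R) - 2 • (s k • X) + 2 • (s k • X) ^ 2)) l (𝓝 1) := by
  have h1 : Tendsto (fun k => (1 + ε k) • (1 : Matrix (Fin 3) (Fin 3) R)) l (𝓝 (((1 : R) + 0) • (1 : Matrix (Fin 3) (Fin 3) R))) :=
    ((tendsto_const_nhds (x := (1 : R))).add hε).smul_const (1 : Matrix (Fin 3) (Fin 3) R)
  have h2 : Tendsto (fun k => 2 • (s k • X)) l (𝓝 (2 • ((0 : R) • X))) := (hs.smul_const _).const_smul 2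
  have h3 : Tendsto (fun k => 2 • (s k • X) ^ 2) l (𝓝 (2 • ((0 : R) • X) ^ 2)) := ((hs.smul_const _).pow 2).const_smul 2
  have := hu'.smul ((h1.sub h2).add h3)
  simpa using this

end Limits

section Scalars

variable (L : Type) [Field L] [NumberField L] [IsCMField L]

/-- **A real (`c̄`-fixed) non-zero `s ∈ L` with `v_w(s) = exp(−2) < 1`** at a conjugation-stable place `w`: `s = b b̄` for a uniformiser `b`
(`v_w(b̄) = v_w(b)`, ★ `valuation_algEquiv_smul`). [cite: Rogawski1990, §3.6] -/
theorem exists_real_valuation_eq_exp_neg_two (w : HeightOneSpectrum (𝓞 L)) (hw : IsCMField.complexConj L • w = w) :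
    ∃ s : L, IsCMField.complexConj L s = s ∧ s ≠ 0 ∧ w.valuation L s = WithZero.exp (-2 : ℤ) := by
  obtain ⟨b, hb⟩ := w.valuation_exists_uniformizer L
  have hb0 : b ≠ 0 := by
    intro h; rw [h, map_zero] at hb; exact WithZero.zero_ne_coe hb
  have hcb : w.valuation L (IsCMField.complexConj L b) = WithZero.exp (-1 : ℤ) := by
    have h := Literature.NumberTheory.Automorphic.HeightOneSpectrum.valuation_algEquiv_smul _ (IsCMField.complexConj L) w b
    rw [hw] at h
    rw [h, hb]
  refine ⟨b * IsCMField.complexConj L b, ?_, mul_ne_zero hb0 (by rw [ne_eq, map_eq_zero]; exact hb0), ?_⟩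
  · rw [map_mul, IsCMField.complexConj_apply_apply, mul_comm]
  · rw [map_mul, hb, hcb, ← WithZero.exp_add]; norm_num

/-- **`s^k → 0` in `Π_{w' ∣ v} L_{w'}`** at a non-split `v` when `v_w(s) < 1` (one place above `v`; `‖·‖ < 1 ⟺ v < 1` in the normed field `L_w`).
[cite: Rogawski1990, §3.6] -/
theorem tendsto_pow_algebraMap_localRing (v : HeightOneSpectrum (𝓞 ↥(maximalRealSubfield L))) (w : PlacesOver L v)
    (hw : IsCMField.complexConj L • w.1 = w.1) {s : L} (hs : w.1.valuation L s < 1) :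
    Tendsto (fun k : ℕ => (algebraMap L (LocalRing L v) s) ^ k) atTop (𝓝 0) := by
  have hc1 : IsCMField.complexConj L ≠ 1 := IsCMField.complexConj_ne_one L
  refine tendsto_pi_nhds.2 fun w' => ?_
  obtain rfl := PlacesOver.eq_of_smul_eq (IsCMField.complexConj L) hc1 w hw w'
  simp only [Pi.pow_apply, Pi.algebraMap_apply, Pi.zero_apply]
  refine tendsto_pow_atTop_nhds_zero_of_norm_lt_one ?_
  have hv : Valued.v (algebraMap L (w'.1.adicCompletion L) s) = w'.1.valuation L s :=
    HeightOneSpectrum.valuedAdicCompletion_eq_valuation' w'.1 s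
  rw [Valued.toNormedField.norm_lt_one_iff, hv]
  exact hs

/-- **`(1 + e_k) u_k = 1`, `e_k → 0` ⟹ `u_k → 1` in `Π_{w' ∣ v} L_{w'}`** at a non-split `v` (read in the field `L_w`, `Tendsto.inv₀`). [folklore] -/
theorem tendsto_of_one_add_mul_eq_one (v : HeightOneSpectrum (𝓞 ↥(maximalRealSubfield L))) (w : PlacesOver L v)
    (hw : IsCMField.complexConj L • w.1 = w.1) (e u : ℕ → LocalRing L v) (he : Tendsto e atTop (𝓝 0))
    (hu : ∀ k, (1 + e k) * u k = 1) : Tendsto u atTop (𝓝 1) := by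
  have hc1 : IsCMField.complexConj L ≠ 1 := IsCMField.complexConj_ne_one L
  refine tendsto_pi_nhds.2 fun w' => ?_
  obtain rfl := PlacesOver.eq_of_smul_eq (IsCMField.complexConj L) hc1 w hw w'
  have he' : Tendsto (fun k => 1 + e k w') atTop (𝓝 1) := by
    have := (tendsto_pi_nhds.1 he) w'
    simpa using (tendsto_const_nhds (x := (1 : w'.1.adicCompletion L))).add this
  have hu' : ∀ k, u k w' = (1 + e k w')⁻¹ := fun k => by
    have h := congrFun (hu k) w'
    simp only [Pi.mul_apply, Pi.add_apply, Pi.one_apply] at h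
    exact (eq_inv_of_mul_eq_one_right h)
  rw [show (fun k => u k w') = fun k => (1 + e k w')⁻¹ from funext hu', Pi.one_apply]
  simpa using he'.inv₀ one_ne_zero

end Scalars

/-! ## §3 The regular elements of the type-(3) torus accumulate at `1` -/

variable (L : Type) [Field L] [NumberField L] [IsCMField L]

/-- **«T3-NEBOT★»: at a NON-SPLIT finite place `v` of `L⁺` there is a subgroup `T ≤ U(Φ₃)(L⁺_v) = Gqs L v` (the centraliser of a regular elliptic
element of type (3)) which contains a regular element, all of whose regular elements have characteristic polynomials WITHOUT root in `L ⊗ L⁺_v`,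
and whose REGULAR ELEMENTS ACCUMULATE AT `1`: `𝓝[T ∩ regular] 1 ≠ ⊥`** — so the (GERM-3) germ filter of the leaf's `stub_EllipticPackage` is non-trivial.
Proof: the unitary regular elements `γ_k = Cayley(s^k • X)` of §1–§2 lie in `T = centraliser {γ_0}` and tend to `1` in the `GL`-topology.
[cite: Rogawski1990, §3.6; §8.1; Lemma 12.7.2 (proof) p. 194] -/
theorem nhdsWithin_typeThree_regular_neBot (v : HeightOneSpectrum (𝓞 ↥(maximalRealSubfield L)))
    (hv : ∀ w : PlacesOver L v, IsCMField.complexConj L • w.1 = w.1) :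
    ∃ T : Subgroup (Gqs L v),
      (∃ γ ∈ T, IsRegularElt (γ.val : GL (Fin 3) (UnitaryGroup.LocalRing L v))) ∧
      (∀ γ ∈ T, IsRegularElt (γ.val : GL (Fin 3) (UnitaryGroup.LocalRing L v)) →
        ∀ c : UnitaryGroup.LocalRing L v, ¬ ((γ.val.val : Matrix (Fin 3) (Fin 3) (UnitaryGroup.LocalRing L v)).charpoly).IsRoot c) ∧
      (𝓝[((T : Set (Gqs L v)) ∩ {γ | IsRegularElt (γ.val : GL (Fin 3) (UnitaryGroup.LocalRing L v))})] (1 : Gqs L v)).NeBot := by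
  classical
  have hc1 : IsCMField.complexConj L ≠ 1 := IsCMField.complexConj_ne_one L
  obtain ⟨w⟩ := (inferInstance : Nonempty (PlacesOver L v))
  have hw : IsCMField.complexConj L • w.1 = w.1 := hv w
  -- `R = L ⊗ L⁺_v` is a field of characteristic `0` (one place above `v`)
  have hF : IsField (LocalRing L v) := LocalRing.isField_of_smul_eq (IsCMField.complexConj L) hc1 w hw
  haveI : IsDomain (LocalRing L v) := hF.isDomain
  haveI : CharZero (LocalRing L v) := charZero_of_injective_algebraMap (algebraMap L (LocalRing L v)).injective
  -- scalars: the imaginary `c₀` (`3 ∤ v_w(c₀)`) and the real `s` (`v_w(s) = exp (−2)`)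
  obtain ⟨c₀, hcc₀, hc₀0, h3⟩ := exists_imaginary_valuation_log_not_dvd_three L w.1 hw
  obtain ⟨s, hcs, hs0, hvs⟩ := exists_real_valuation_eq_exp_neg_two L w.1 hw
  have hσc : conjLocal L (IsCMField.complexConj L) v (algebraMap L (LocalRing L v) c₀) = -algebraMap L (LocalRing L v) c₀ := by
    rw [conjLocal_algebraMap, hcc₀, map_neg]
  have hσs : ∀ k : ℕ, conjLocal L (IsCMField.complexConj L) v (algebraMap L (LocalRing L v) s ^ k) = algebraMap L (LocalRing L v) s ^ k := by
    intro k; rw [map_pow, conjLocal_algebraMap, hcs]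
  -- `3 ∤ v_w(s^{3k} c₀)` for every `k`
  have h3k : ∀ k : ℕ, ¬ (3 : ℤ) ∣ WithZero.log (w.1.valuation L ((s ^ k) ^ 3 * c₀)) := by
    intro k hk
    have hvs0 : w.1.valuation L s ≠ 0 := (Valuation.ne_zero_iff _).2 hs0
    have hvc0 : w.1.valuation L c₀ ≠ 0 := (Valuation.ne_zero_iff _).2 hc₀0
    rw [map_mul, map_pow, map_pow, WithZero.log_mul (pow_ne_zero _ (pow_ne_zero _ hvs0)) hvc0, WithZero.log_pow, WithZero.log_pow] at hk
    apply h3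
    have : (3 : ℤ) ∣ 3 • k • WithZero.log (w.1.valuation L s) :=
      ⟨k • WithZero.log (w.1.valuation L s), by rw [nsmul_eq_mul]; norm_num⟩
    exact (Int.dvd_add_right this).1 hk
  -- name the test matrix and the scalar families
  obtain ⟨X₀, hX₀⟩ : ∃ X₀ : Matrix (Fin 3) (Fin 3) (LocalRing L v), X₀ = !![0, 0, algebraMap L (LocalRing L v) c₀; 1, 0, 0; 0, -1, 0] := ⟨_, rfl⟩
  obtain ⟨t, ht⟩ : ∃ t : ℕ → LocalRing L v, t = fun k => algebraMap L (LocalRing L v) s ^ k := ⟨_, rfl⟩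
  obtain ⟨ε, hε⟩ : ∃ ε : ℕ → LocalRing L v, ε = fun k => t k ^ 3 * algebraMap L (LocalRing L v) c₀ := ⟨_, rfl⟩
  have hεalg : ∀ k, ε k = algebraMap L (LocalRing L v) ((s ^ k) ^ 3 * c₀) := by
    intro k; rw [hε, ht]; simp only [map_mul, map_pow]
  -- the scaled Lie elements `X_k = t_k • X₀`
  have hLie : ∀ k, ((t k • X₀).map (conjLocal L (IsCMField.complexConj L) v))ᵀ * cmLocalForm L 3 v = -(cmLocalForm L 3 v * (t k • X₀)) := by
    intro k
    refine transpose_map_smul_mul_eq _ ?_ (by rw [ht]; exact hσs k)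
    rw [cmLocalForm_three_eq, hX₀]
    exact transpose_map_testMatrix_mul_antidiag _ _ hσc
  have hX3 : ∀ k, (t k • X₀) ^ 3 = -(ε k • (1 : Matrix (Fin 3) (Fin 3) (LocalRing L v))) := by
    intro k; rw [hX₀, smul_testMatrix_pow_three, hε]
  have hchar : ∀ k, (t k • X₀).charpoly = Polynomial.X ^ 3 + Polynomial.C (ε k) := by
    intro k; rw [hX₀, charpoly_smul_testMatrix, hε]
  have hnoroot : ∀ k (r : LocalRing L v), r ^ 3 + ε k ≠ 0 := by
    intro k r; rw [hεalg]; exact pow_three_add_algebraMap_ne_zero L v w (h3k k) r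
  have hirr : ∀ k, Irreducible (t k • X₀).charpoly := by
    intro k; rw [hchar]; exact irreducible_X_pow_three_add_C _ (hnoroot k)
  -- `1 ± ε_k` are units
  have h1ε : ∀ k, 1 + ε k ≠ 0 := fun k h => hnoroot k 1 (by rw [one_pow]; exact h)
  have h1ε' : ∀ k, 1 - ε k ≠ 0 := fun k h => hnoroot k (-1) (by
    rw [show ((-1 : LocalRing L v)) ^ 3 + ε k = -(1 - ε k) by ring, h, neg_zero])
  choose u hu using fun k => hF.mul_inv_cancel (h1ε k)
  choose u' hu' using fun k => hF.mul_inv_cancel (h1ε' k)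
  have hunit₁ : ∀ k, IsUnit (1 - t k • X₀) := fun k => IsUnit.of_mul_eq_one _ (one_sub_mul_eq_one_of_pow_three _ (hX3 k) (hu k))
  have hunit₂ : ∀ k, IsUnit (1 + t k • X₀) := fun k => IsUnit.of_mul_eq_one _ (one_add_mul_eq_one_of_pow_three _ (hX3 k) (hu' k))
  -- the unitary Cayley transforms `γ_k` (★ «CAYLEY★», any commutative ring)
  choose g hgU hgcoe using fun k =>
    exists_mem_unitaryGroupOfForm_coe_eq_cayley (conjLocal L (IsCMField.complexConj L) v) (hLie k) (hunit₁ k) (hunit₂ k)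
  -- closed forms of `γ_k` and `γ_k⁻¹`
  have hval : ∀ k, (g k).val =
      u k • ((1 - ε k) • (1 : Matrix (Fin 3) (Fin 3) (LocalRing L v)) + 2 • (t k • X₀) + 2 • (t k • X₀) ^ 2) := by
    intro k; rw [hgcoe k]; exact cayley_eq_smul_of_pow_three _ (hX3 k) (hu k)
  have hinv : ∀ k, (g k)⁻¹.val =
      u' k • ((1 + ε k) • (1 : Matrix (Fin 3) (Fin 3) (LocalRing L v)) - 2 • (t k • X₀) + 2 • (t k • X₀) ^ 2) := by
    intro k
    rw [Matrix.coe_units_inv, hgcoe k, Matrix.inv_eq_right_inv (cayley_mul_cayleyInv _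
      ((Matrix.isUnit_iff_isUnit_det _).1 (hunit₁ k)) ((Matrix.isUnit_iff_isUnit_det _).1 (hunit₂ k)))]
    exact cayleyInv_eq_smul_of_pow_three _ (hX3 k) (hu' k)
  -- the elements of `Gqs L v`
  let γ : ℕ → Gqs L v := fun k => ⟨g k, hgU k⟩
  -- they commute (all lie in `R[X₀]`): `γ_k ∈ T := centraliser {γ_0}`
  have hmemAdj : ∀ k, (g k).val ∈
      Algebra.adjoin (LocalRing L v) ({X₀} : Set (Matrix (Fin 3) (Fin 3) (LocalRing L v))) := by
    intro k; rw [hval]; exact mem_adjoin_cayleyClosedForm X₀ (u k) (1 - ε k) (t k)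
  have hcomm : ∀ k, Commute (g 0).val
      (g k).val := fun k =>
    Algebra.commute_of_mem_adjoin_singleton_of_commute (hmemAdj k) (Algebra.commute_of_mem_adjoin_self (hmemAdj 0)).symm
  have hmemT : ∀ k, γ k ∈ Subgroup.centralizer ({γ 0} : Set (Gqs L v)) := by
    intro k
    refine Subgroup.mem_centralizer_iff.2 fun h hh => ?_
    rw [Set.mem_singleton_iff] at hh
    subst hh
    exact Subtype.ext (Units.ext (hcomm k).eq)
  -- regularity and the no-root clause (in the field structure of `R`)
  have hreg : ∀ k, IsRegularElt (g k) := by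
    intro k
    letI : Field (LocalRing L v) := hF.toField
    have h2 : (2 : LocalRing L v) ≠ 0 := two_ne_zero
    have hirrg : Irreducible (g k).val.charpoly := by
      rw [hgcoe]; exact irreducible_charpoly_cayley_fin_three h2 (hirr k)
    exact isRegularElt_of_irreducible_charpoly_of_charZero _ hirrg
  have hnoRoot : ∀ γ' ∈ Subgroup.centralizer ({γ 0} : Set (Gqs L v)),
      IsRegularElt (γ'.val : GL (Fin 3) (UnitaryGroup.LocalRing L v)) →
        ∀ c : UnitaryGroup.LocalRing L v, ¬ ((γ'.val.val : Matrix (Fin 3) (Fin 3) (UnitaryGroup.LocalRing L v)).charpoly).IsRoot c := by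
    intro γ' hγ' hreg' c
    have hcomm' : Commute (g 0).val (γ'.val.val) := by
      have h := (Subgroup.mem_centralizer_iff.1 hγ') (γ 0) (Set.mem_singleton _)
      have h' : (γ 0).val * γ'.val = γ'.val * (γ 0).val := congrArg Subtype.val h
      have h'' := congrArg Units.val h'
      simp only [Units.val_mul] at h''
      exact h''
    letI : Field (LocalRing L v) := hF.toField
    have h2 : (2 : LocalRing L v) ≠ 0 := two_ne_zero
    have hirr0 : Irreducible (g 0).val.charpoly := by
      rw [hgcoe]; exact irreducible_charpoly_cayley_fin_three h2 (hirr 0)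
    exact not_isRoot_charpoly_of_commute_of_isRegularElt hirr0 γ'.val hcomm' hreg' c
  -- the limit `γ_k → 1` in `Gqs L v`
  have ht0 : Tendsto t atTop (𝓝 0) := by
    rw [ht]; exact tendsto_pow_algebraMap_localRing L v w hw (by rw [hvs]; exact WithZero.exp_lt_exp.2 (by norm_num))
  have hε0 : Tendsto ε atTop (𝓝 0) := by
    rw [hε]; simpa using (ht0.pow 3).mul_const (algebraMap L (LocalRing L v) c₀)
  have hu1 : Tendsto u atTop (𝓝 1) := tendsto_of_one_add_mul_eq_one L v w hw ε u hε0 hu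
  have hu'1 : Tendsto u' atTop (𝓝 1) :=
    tendsto_of_one_add_mul_eq_one L v w hw (fun k => -ε k) u' (by simpa using hε0.neg) (fun k => by rw [← sub_eq_add_neg]; exact hu' k)
  have hγval : Tendsto (fun k => (g k).val) atTop (𝓝 1) := by
    rw [show (fun k => (g k).val) = _ from funext hval]
    exact tendsto_cayley_closedForm X₀ u ε t hu1 hε0 ht0
  have hγinv : Tendsto (fun k => (g k)⁻¹.val) atTop (𝓝 1) := by
    rw [show (fun k => (g k)⁻¹.val) = _ from funext hinv]
    exact tendsto_cayleyInv_closedForm X₀ u' ε t hu'1 hε0 ht0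
  have hγGL : Tendsto g atTop (𝓝 1) := by
    rw [Units.isInducing_embedProduct.tendsto_nhds_iff]
    simp only [Function.comp_def, Units.embedProduct_apply, inv_one, Units.val_one, MulOpposite.op_one]
    exact hγval.prodMk_nhds ((MulOpposite.continuous_op.tendsto 1).comp hγinv)
  have hγ : Tendsto γ atTop (𝓝 1) :=
    (Topology.IsInducing.subtypeVal.tendsto_nhds_iff (f := γ) (l := atTop) (y := (1 : Gqs L v))).2 hγGL
  -- conclusion
  refine ⟨Subgroup.centralizer ({γ 0} : Set (Gqs L v)), ⟨γ 0, hmemT 0, hreg 0⟩, hnoRoot, ?_⟩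
  refine mem_closure_iff_nhdsWithin_neBot.1 (mem_closure_of_tendsto hγ (Eventually.of_forall fun k => ⟨hmemT k, hreg k⟩))

end Summit.HodgeConjecture.HodgeConjecture.Cruxes.H413.F0P3cStCharTSTypeThreeNhds
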